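import Summits.ResolutionOfSingularities.ResolutionOfSingularities.Theorems.WeightedInvariantHypersurfaceCentreAssemblyStalkDict
import Summits.ResolutionOfSingularities.ResolutionOfSingularities.Theorems.WeightedInvariantIotaMaxStratum
import Summits.ResolutionOfSingularities.ResolutionOfSingularities.Theorems.WeightedInvariantHypersurfaceCentreAssemblyMaxLocus
import HarnessLib

/-!
# Door assembly H2c″ — the SQUEEZE LEMMA: `ι` along specialisations and on irreducible closed sets

Route `ResolutionOfSingularities/WeightedInvariant`, crux `Theses.WeightedInvariant.HypersurfaceCentreConstruction`
(stmt-ResolutionOfSingularities-19897), door line `local-engine`; res-L1-w43-plan-1 ORDER (o21) (idea-2's (F12) made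
kernel).  For the local game's rank `ι : (R, g) ↦ Ordinal` read at the points of the smooth ambient `Y` on local
equations of the locally principal hypersurface ideal `X` (`iotaAt ι X y = ι(𝒪_{Y,y}, f_y)`, stub-9's
`…CentreAssemblyDefs`), under the clauses (c6) `IotaIsoInvariant`, (c7) `IotaGenerizationMonotone`, (c8)
`IotaUpperSemicontinuous`, (c12a) `IotaUnitInvariant` of `…LocalGameEFT3` (HYPOTHESES on an arbitrary `ι`):

* (a) `iotaAt_le_of_specializes` — if `y' ⤳ y` (`y ∈ closure {y'}`) then `iotaAt ι X y' ≤ iotaAt ι X y`: on a principal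
  affine chart `U ∋ y` (hence `∋ y'`) with `X(U) = (F)`, `iotaAt` is `ι` of `F/1` in `Γ(Y,U)_𝔮` resp. `Γ(Y,U)_{𝔮'}`
  (stub-9's `iotaAt_eq_iota_localization`, (c6)+(c12a)), `𝔮' ≤ 𝔮`, and `Γ(Y,U)_{𝔮'}` is the localisation of the REGULAR
  local ring `Γ(Y,U)_𝔮 ≅ 𝒪_{Y,y}` at `𝔮'Γ(Y,U)_𝔮`, so (c7) applies (through (c6) along
  `IsLocalization.algEquiv`);
* `isOpen_setOf_iotaAt_le` — SUB-level sets `{y | iotaAt ι X y ≤ α}` are open (complement of the superlevel set at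
  `α + 1`, closed by res-type-057's `isClosed_superlevel_iota_of_stalkGenerators` from (c6)+(c8)+(c12a)); no finiteness
  of the value set is needed because ordinals have successors;
* (b′) `iotaAt_le_of_isGenericPoint` — on an irreducible closed `Z ⊆ Y` with generic point `ξ`, `ι(ξ) ≤ ι(y)` for all
  `y ∈ Z`; (b″) `isOpen_preimage_setOf_iotaAt_eq_genericPoint` / `…_nonempty` — `{y ∈ Z | ι(y) = ι(ξ)}` is open in `Z`
  and contains `ξ`; `setOf_iotaAt_eq_genericPoint_eq_inter` — it is `Z ∩ {ι ≤ ι(ξ)}`.  So `ι` is generically CONSTANT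
  `= ι(ξ)` on `Z` and jumps UP on a proper closed subset (the (strat)/(F14) reasoning: the value at a non-closed point is
  dictated by the points of a dense open of its closure); `exists_closedPoint_specializes_iotaAt_eq` — every point
  specialises to a CLOSED point with the same `ι` (Jacobson property of schemes locally of finite type over a field).

Def-free helper (`--supports stmt-ResolutionOfSingularities-19897`); nothing here asserts any clause or anything about
resolution of singularities in characteristic `p`; AI-written, weaker than expert review. [OURS · L1 W4.3]
-/

noncomputable section

set_option linter.dupNamespace false -- mandated namespace of this single-conjunct summit

open CategoryTheory AlgebraicGeometry TopologicalSpace IsLocalRing Topology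
open Literature.AlgebraicGeometry.Resolution
open Summit.ResolutionOfSingularities.ResolutionOfSingularities.Theorems

namespace Summit.ResolutionOfSingularities.ResolutionOfSingularities.Cruxes.HypersurfaceCentreConstruction.LocalEngine

variable (ι : (R : Type) → [CommRing R] → R → Ordinal.{0})

/-! ## Commutative algebra: (c7) between two primes `𝔮' ≤ 𝔮` of a ring with regular `A_𝔮` -/

section TwoPrimes

variable {A : Type} [CommRing A]

/-- **(c7) between two primes.**  If `𝔮' ≤ 𝔮` are primes of `A` with `A_𝔮` a regular local ring and `ι` satisfies (c6)
and (c7), then `ι(A_{𝔮'}, F/1) ≤ ι(A_𝔮, F/1)`: `A_{𝔮'}` is (isomorphic over `A` to) the localisation of `A_𝔮` at the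
prime `𝔮'A_𝔮`. [folklore] -/
theorem iota_localization_le_of_le (hc6 : IotaIsoInvariant ι) (hc7 : IotaGenerizationMonotone ι)
    {𝔮 𝔮' : Ideal A} [𝔮.IsPrime] [𝔮'.IsPrime] (hle : 𝔮' ≤ 𝔮)
    [IsRegularLocalRing (Localization.AtPrime 𝔮)] (F : A) :
    ι (Localization.AtPrime 𝔮') (algebraMap A (Localization.AtPrime 𝔮') F) ≤
      ι (Localization.AtPrime 𝔮) (algebraMap A (Localization.AtPrime 𝔮) F) := by
  -- the prime `𝔭 = 𝔮' A_𝔮` of `S = A_𝔮`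
  set S := Localization.AtPrime 𝔮 with hS
  have hdisj : Disjoint (𝔮.primeCompl : Set A) (𝔮' : Set A) := by
    rw [Set.disjoint_left]
    intro a ha ha'
    exact ha (hle ha')
  set 𝔭 : Ideal S := 𝔮'.map (algebraMap A S) with h𝔭
  haveI h𝔭p : 𝔭.IsPrime := IsLocalization.isPrime_of_isPrime_disjoint 𝔮.primeCompl S 𝔮' ‹_› hdisj
  have hunder : 𝔭.under A = 𝔮' := IsLocalization.under_map_of_isPrime_disjoint 𝔮.primeCompl S ‹_› hdisj
  -- `Localization.AtPrime 𝔭` is a localisation of `A` at `𝔮'`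
  have hM : (𝔭.under A).primeCompl = 𝔮'.primeCompl := by
    ext a
    simp only [Ideal.mem_primeCompl_iff, hunder]
  haveI : IsLocalization 𝔮'.primeCompl (Localization.AtPrime 𝔭) := by
    rw [← hM]
    exact IsLocalization.isLocalization_isLocalization_atPrime_isLocalization 𝔮.primeCompl
      (Localization.AtPrime 𝔭) 𝔭
  let e : Localization.AtPrime 𝔮' ≃ₐ[A] Localization.AtPrime 𝔭 :=
    IsLocalization.algEquiv 𝔮'.primeCompl (Localization.AtPrime 𝔮') (Localization.AtPrime 𝔭)
  have he : e (algebraMap A (Localization.AtPrime 𝔮') F) =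
      algebraMap S (Localization.AtPrime 𝔭) (algebraMap A S F) := by
    rw [AlgEquiv.commutes, IsScalarTower.algebraMap_apply A S (Localization.AtPrime 𝔭)]
  -- (c6) along `e`, then (c7) in the regular local ring `S`
  have h6 : ι (Localization.AtPrime 𝔭) (e (algebraMap A (Localization.AtPrime 𝔮') F)) =
      ι (Localization.AtPrime 𝔮') (algebraMap A (Localization.AtPrime 𝔮') F) :=
    hc6 _ _ e.toRingEquiv (algebraMap A (Localization.AtPrime 𝔮') F)
  rw [← h6, he]
  exact hc7 S 𝔭 (algebraMap A S F)

end TwoPrimes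

/-! ## (a) `ι` does not increase under generisation of the point -/

section Specializes

variable {k : Type} [Field k] {Y : Scheme.{0}} (f : Y ⟶ Spec (.of k))

/-- In an affine open `U`, a specialisation `y' ⤳ y` of points of `U` is the inclusion `𝔮_{y'} ≤ 𝔮_y` of the
corresponding primes of `Γ(Y, U)`. [folklore] -/
theorem primeIdealOf_le_of_specializes (U : Y.affineOpens) {y y' : Y} (hy : y ∈ (U : Y.Opens))
    (hy' : y' ∈ (U : Y.Opens)) (h : y' ⤳ y) :
    (U.2.primeIdealOf ⟨y', hy'⟩).asIdeal ≤ (U.2.primeIdealOf ⟨y, hy⟩).asIdeal := by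
  -- transport the specialisation along the open immersion `fromSpec : Spec Γ(Y,U) → Y`
  have hemb := U.2.fromSpec.isOpenEmbedding
  have hspec : U.2.primeIdealOf ⟨y', hy'⟩ ⤳ U.2.primeIdealOf ⟨y, hy⟩ := by
    refine hemb.isInducing.specializes_iff.mp ?_
    rw [IsAffineOpen.fromSpec_primeIdealOf, IsAffineOpen.fromSpec_primeIdealOf]
    exact h
  exact (PrimeSpectrum.le_iff_specializes _ _).mpr hspec

/-- **(a) `ι` along specialisations.**  For `Y` smooth over a field, `X` a locally principal ideal sheaf and `ι` with
(c6) iso-invariance, (c7) generisation-monotonicity on regular local rings and (c12a) unit-invariance: if `y' ⤳ y`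
(`y` lies in the closure of `y'`) then `iotaAt ι X y' ≤ iotaAt ι X y`. [folklore] -/
theorem iotaAt_le_of_specializes (hc6 : IotaIsoInvariant ι) (hc7 : IotaGenerizationMonotone ι)
    (hu : IotaUnitInvariant ι) [Smooth f] (X : Y.IdealSheafData) (hX : IsLocallyPrincipal X) {y y' : Y}
    (h : y' ⤳ y) : iotaAt ι X y' ≤ iotaAt ι X y := by
  -- a principal affine chart through `y`, hence through `y'`
  obtain ⟨U, hyU, F, hF⟩ := hX y
  have hy'U : y' ∈ (U : Y.Opens) := h.mem_open U.1.isOpen hyU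
  rw [iotaAt_eq_iota_localization ι (hy := hyU) f hc6 hu X hF,
    iotaAt_eq_iota_localization ι (hy := hy'U) f hc6 hu X hF]
  -- `Γ(Y,U)_𝔮 ≅ 𝒪_{Y,y}` is regular local (`Y` smooth over a field)
  haveI : IsRegularLocalRing (Y.presheaf.stalk y) := isRegularLocalRing_stalk_of_smooth_of_field f y
  haveI : IsRegularLocalRing (Localization.AtPrime (U.2.primeIdealOf ⟨y, hyU⟩).asIdeal) :=
    IsRegularLocalRing.of_ringEquiv (stalkEquiv U hyU).symm
  exact iota_localization_le_of_le ι hc6 hc7 (primeIdealOf_le_of_specializes U hyU hy'U h) F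

end Specializes

/-! ## Sub-level sets are open; the squeeze on an irreducible closed set -/

section Squeeze

variable {k : Type} [Field k] {Y : Scheme.{0}} (f : Y ⟶ Spec (.of k))

/-- **Sub-level sets of `ι` are open**: `{y | iotaAt ι X y ≤ α}` is open for every ordinal `α` (it is the complement of the
superlevel set `{α + 1 ≤ ι}`, closed by (c6)+(c8)+(c12a) — `isClosed_superlevel_iota_of_stalkGenerators`).  No
finiteness of the set of values is needed. [folklore] -/
theorem isOpen_setOf_iotaAt_le (hc6 : IotaIsoInvariant ι) (hc8 : IotaUpperSemicontinuous ι)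
    (hu : IotaUnitInvariant ι) [Smooth f] (X : Y.IdealSheafData) (hX : IsLocallyPrincipal X) (α : Ordinal.{0}) :
    IsOpen {y : Y | iotaAt ι X y ≤ α} := by
  have hcl := isClosed_superlevel_iota_of_stalkGenerators ι hc6 hc8 (fun R _ v g => hu R (v : R) g v.isUnit) f X hX
    (fun y => localGenerator X y) (stalkIdeal_eq_span_localGenerator_of_isLocallyPrincipal X hX) (Order.succ α)
  have hEq : {y : Y | iotaAt ι X y ≤ α} = {y : Y | Order.succ α ≤ ι (Y.presheaf.stalk y) (localGenerator X y)}ᶜ := by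
    ext y
    simp only [Set.mem_setOf_eq, Set.mem_compl_iff, Order.succ_le_iff, not_lt]
    rfl
  rw [hEq]
  exact hcl.isOpen_compl

/-- Super-level sets of `iotaAt` are closed ((c6)+(c8)+(c12a); `isClosed_superlevel_iota_of_stalkGenerators` at
`g := localGenerator X`). [folklore] -/
theorem isClosed_setOf_le_iotaAt (hc6 : IotaIsoInvariant ι) (hc8 : IotaUpperSemicontinuous ι)
    (hu : IotaUnitInvariant ι) [Smooth f] (X : Y.IdealSheafData) (hX : IsLocallyPrincipal X) (α : Ordinal.{0}) :
    IsClosed {y : Y | α ≤ iotaAt ι X y} :=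
  isClosed_superlevel_iota_of_stalkGenerators ι hc6 hc8 (fun R _ v g => hu R (v : R) g v.isUnit) f X hX
    (fun y => localGenerator X y) (stalkIdeal_eq_span_localGenerator_of_isLocallyPrincipal X hX) α

/-- **(b′) the generic point minimises `ι` on its closure**: for `Z ⊆ Y` with generic point `ξ` (`closure {ξ} = Z`),
`iotaAt ι X ξ ≤ iotaAt ι X y` for every `y ∈ Z` ((a) at `ξ ⤳ y`). [folklore] -/
theorem iotaAt_le_of_isGenericPoint (hc6 : IotaIsoInvariant ι) (hc7 : IotaGenerizationMonotone ι)
    (hu : IotaUnitInvariant ι) [Smooth f] (X : Y.IdealSheafData) (hX : IsLocallyPrincipal X) {Z : Set Y} {ξ : Y}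
    (hξ : IsGenericPoint ξ Z) {y : Y} (hy : y ∈ Z) : iotaAt ι X ξ ≤ iotaAt ι X y :=
  iotaAt_le_of_specializes ι f hc6 hc7 hu X hX (hξ.specializes hy)

/-- On `Z` with generic point `ξ`, the locus where `ι` takes its generic value is the trace of the (open) sub-level set
`{ι ≤ ι(ξ)}`. [folklore] -/
theorem setOf_iotaAt_eq_genericPoint_eq_inter (hc6 : IotaIsoInvariant ι) (hc7 : IotaGenerizationMonotone ι)
    (hu : IotaUnitInvariant ι) [Smooth f] (X : Y.IdealSheafData) (hX : IsLocallyPrincipal X) {Z : Set Y} {ξ : Y}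
    (hξ : IsGenericPoint ξ Z) :
    {y | y ∈ Z ∧ iotaAt ι X y = iotaAt ι X ξ} = Z ∩ {y | iotaAt ι X y ≤ iotaAt ι X ξ} := by
  ext y
  simp only [Set.mem_setOf_eq, Set.mem_inter_iff]
  constructor
  · rintro ⟨hy, heq⟩
    exact ⟨hy, heq.le⟩
  · rintro ⟨hy, hle⟩
    exact ⟨hy, le_antisymm hle (iotaAt_le_of_isGenericPoint ι f hc6 hc7 hu X hX hξ hy)⟩

/-- **(b″) the generic value is taken on an OPEN subset of `Z`**: `{y ∈ Z | iotaAt ι X y = iotaAt ι X ξ}` is open in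
the subspace `Z` ((b′) + openness of the sub-level set `{ι ≤ ι(ξ)}` from (c8)). [folklore] -/
theorem isOpen_preimage_setOf_iotaAt_eq_genericPoint (hc6 : IotaIsoInvariant ι) (hc7 : IotaGenerizationMonotone ι)
    (hc8 : IotaUpperSemicontinuous ι) (hu : IotaUnitInvariant ι) [Smooth f] (X : Y.IdealSheafData)
    (hX : IsLocallyPrincipal X) {Z : Set Y} {ξ : Y} (hξ : IsGenericPoint ξ Z) :
    IsOpen ((fun z : Z => (z : Y)) ⁻¹' {y | iotaAt ι X y = iotaAt ι X ξ}) := by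
  have hEq : ((fun z : Z => (z : Y)) ⁻¹' {y | iotaAt ι X y = iotaAt ι X ξ}) =
      (fun z : Z => (z : Y)) ⁻¹' {y | iotaAt ι X y ≤ iotaAt ι X ξ} := by
    ext z
    simp only [Set.mem_preimage, Set.mem_setOf_eq]
    exact ⟨fun h => h.le, fun h => le_antisymm h (iotaAt_le_of_isGenericPoint ι f hc6 hc7 hu X hX hξ z.2)⟩
  rw [hEq]
  exact (isOpen_setOf_iotaAt_le ι f hc6 hc8 hu X hX _).preimage continuous_subtype_val

/-- **(b″), non-emptiness**: the generic point itself lies in `{y ∈ Z | iotaAt ι X y = iotaAt ι X ξ}`. [folklore] -/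
theorem genericPoint_mem_setOf_iotaAt_eq {X : Y.IdealSheafData} {Z : Set Y} {ξ : Y} (hξ : IsGenericPoint ξ Z) :
    ξ ∈ {y | y ∈ Z ∧ iotaAt ι X y = iotaAt ι X ξ} :=
  ⟨hξ.mem, rfl⟩

/-- **(b″) packaged**: there is an open `V ⊆ Y` with `ξ ∈ V` and `V ∩ Z = {y ∈ Z | iotaAt ι X y = iotaAt ι X ξ}` — `ι` is
constant, equal to its generic value, on the non-empty open subset `V ∩ Z` of the irreducible closed set `Z`, and
strictly larger on the proper closed subset `Z ∖ V`. [folklore] -/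
theorem exists_isOpen_inter_eq_setOf_iotaAt_eq_genericPoint (hc6 : IotaIsoInvariant ι)
    (hc7 : IotaGenerizationMonotone ι) (hc8 : IotaUpperSemicontinuous ι) (hu : IotaUnitInvariant ι) [Smooth f]
    (X : Y.IdealSheafData) (hX : IsLocallyPrincipal X) {Z : Set Y} {ξ : Y} (hξ : IsGenericPoint ξ Z) :
    ∃ V : Set Y, IsOpen V ∧ ξ ∈ V ∧ V ∩ Z = {y | y ∈ Z ∧ iotaAt ι X y = iotaAt ι X ξ} ∧
      ∀ y ∈ Z, y ∉ V → iotaAt ι X ξ < iotaAt ι X y := by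
  refine ⟨{y | iotaAt ι X y ≤ iotaAt ι X ξ}, isOpen_setOf_iotaAt_le ι f hc6 hc8 hu X hX _,
    show iotaAt ι X ξ ≤ iotaAt ι X ξ from le_rfl, ?_, ?_⟩
  · rw [setOf_iotaAt_eq_genericPoint_eq_inter ι f hc6 hc7 hu X hX hξ, Set.inter_comm]
  · intro y hy hyV
    exact lt_of_le_of_ne (iotaAt_le_of_isGenericPoint ι f hc6 hc7 hu X hX hξ hy) fun h => hyV h.ge

/-- **The squeeze along a specialisation chain**: if `y' ⤳ y` and `iotaAt ι X y ≤ iotaAt ι X y'` (e.g. `y` lies in the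
generic-value open of the closure of `y'`), the two values agree. [folklore] -/
theorem iotaAt_eq_of_specializes_of_le (hc6 : IotaIsoInvariant ι) (hc7 : IotaGenerizationMonotone ι)
    (hu : IotaUnitInvariant ι) [Smooth f] (X : Y.IdealSheafData) (hX : IsLocallyPrincipal X) {y y' : Y}
    (h : y' ⤳ y) (hle : iotaAt ι X y ≤ iotaAt ι X y') : iotaAt ι X y = iotaAt ι X y' :=
  le_antisymm hle (iotaAt_le_of_specializes ι f hc6 hc7 hu X hX h)


/-- **Closed points dictate `ι`**: on `Y` smooth over a field (a Jacobson space), every point `y` specialises to a CLOSED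
point `x` with the same `ι`-value — `x` is any closed point of the non-empty locally closed set
`closure {y} ∩ {ι ≤ ι(y)}` ((b″) for `Z = closure {y}`, `ξ = y`). [folklore] -/
theorem exists_closedPoint_specializes_iotaAt_eq (hc6 : IotaIsoInvariant ι) (hc7 : IotaGenerizationMonotone ι)
    (hc8 : IotaUpperSemicontinuous ι) (hu : IotaUnitInvariant ι) [Smooth f] (X : Y.IdealSheafData)
    (hX : IsLocallyPrincipal X) (y : Y) :
    ∃ x ∈ closedPoints Y, y ⤳ x ∧ iotaAt ι X x = iotaAt ι X y := by
  haveI : JacobsonSpace Y := LocallyOfFiniteType.jacobsonSpace f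
  have hξ : IsGenericPoint y (closure {y}) := isGenericPoint_closure
  obtain ⟨V, hV, hyV, hVZ, -⟩ := exists_isOpen_inter_eq_setOf_iotaAt_eq_genericPoint ι f hc6 hc7 hc8 hu X hX hξ
  have hlc : IsLocallyClosed (V ∩ closure {y}) := hV.isLocallyClosed.inter isClosed_closure.isLocallyClosed
  obtain ⟨x, ⟨hxV, hxZ⟩, hxc⟩ :=
    nonempty_inter_closedPoints (Z := V ∩ closure {y}) ⟨y, hyV, subset_closure rfl⟩ hlc
  have hx : x ∈ {y' | y' ∈ closure {y} ∧ iotaAt ι X y' = iotaAt ι X y} := by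
    rw [← hVZ]
    exact ⟨hxV, hxZ⟩
  exact ⟨x, hxc, hξ.specializes hxZ, hx.2⟩

end Squeeze

end Summit.ResolutionOfSingularities.ResolutionOfSingularities.Cruxes.HypersurfaceCentreConstruction.LocalEngine

end
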